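import Summits.ResolutionOfSingularities.ResolutionOfSingularities.Theorems.HilbertSamuelEliminationSigmaMaxModificationsCorridor3WLadderStrataLineages
import Literature.AlgebraicGeometry.Resolution.AlterationsNormalFormStrictTransform
import Literature.AlgebraicGeometry.Resolution.BlowupsLocal
import Literature.AlgebraicGeometry.CossartJannsenSaito2020.KeyTheoremsAPI
import HarnessLib

/-!
# [OURS · L1 W4.2] THE BLOW-UP TOWER OF A CHAIN OF CANONICAL NEAR STEPS — the dictionary «marked-stage chain ↦ CJS `BlowupTower`»
# that every F-key bridge of the W-ladder needs (crux chain w42, line `w_ladder` v6; sockets `Moving.Bridge3M` / `Bridge3SeqM` /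
# `UnitTowerExtractionQM` all conclude `∃ T : BlowupTower, …`; res-type-053's `BlowupTowerLocalize` then localises `T`)

OURS (cell res-hironaka, slot W4.2, LEAD PROVER res-L1-w42-lead-1 gen 3); NOT statements of H. Hironaka's manuscript [Hironaka2017]
nor of [CossartJannsenSaito2020]; AI proving, weaker than expert review. `--supports stmt-ResolutionOfSingularities-19249`.

WHAT IS PROVED (sorry-free, no named fact). For a chain `c : ℕ → MarkedStage` of canonical near steps
(`∀ n, CanonicalNearStep R N ν (c n) (c (n+1))`; tree `…Theorems.CampaignW42`):
* `chainProj hstep n : (c (n+1)).W ⟶ (c n).W` — THE projection of the `n`-th step (a chosen `Moving.StepProjection`, stub-4's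
  p-module `…Corridor3WLadderStrataLineages`; unique for a functional oracle) and `chainCentre hstep n : (c n).W.IdealSheafData` — THE
  centre of the `n`-th step, with `isCanonicalStep_chainCentre`, `isBlowup_chainProj : IsBlowup (chainProj n) (chainCentre n)`
  (transport of `blowup.isBlowup` along the stage identification, tree `IsBlowup.iso_comp`), `chainProj_base_pt` (`x_{n+1} ↦ x_n`),
  `isBlownUp_iff_pt_mem_chainCentre` (GENUINE step at `n` ⇔ `x_n ∈ V(C_n)`, functional oracle).
* `chainTower hstep hrad : BlowupTower` — the CJS tower (`Literature…CossartJannsenSaito2020.BlowupTower`, Def. 6.34 display (6.25))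
  with stages `X n = (c n).W`, centres `C n = V(chainCentre n)` and `π n = chainProj n`, under the hypothesis `hrad` that the centres are
  RADICAL ideal sheaves (the tower blows up centres with their reduced structure; canonical centres are regular — `Helpers.CycleInv.centre`,
  p503609 — hence radical: `radical_eq_of_isRegular_subscheme`); simp-API `chainTower_X/_C/_π`, `centreIdeal_chainTower`,
  `phi_chainTower_base_pt` (`φ_n(x_n) = x_0`), `pt_mem_nearLocus_chainTower` (the marked points are NEAR points over `x_0`:
  `x_n ∈ T.nearLocus N x_0 n` once `x_0 ∈ X_0(ν)`), `geomDirDimAt_chainTower_pt`, `dirDimAt_chainTower_pt`, and `keySetting_chainTower`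
  (`KeySetting T N` from excellence of `X_0` and `dim X_0 ≤ N`).
* (sibling file `…Corridor3ChainTowerOrigin.lean`) from a maximal origin (`ν ≠ Φ^{(N)}`): the radicality hypothesis DISCHARGED from
  `Helpers.CycleInv.centre` (p503609), permissible centres, `KeySetting`, `exists_chainTower_of_isMaximalOrigin`.
This is bookkeeping only (no geometry beyond the tree's): it lets a bridge prover START from a CJS tower whose initial segment is
the chain, to be localised at `x_n` (`BlowupTower.baseChange`, res-type-053) and compressed along waiting steps (ruling v3.8-B (B-2)).

## References

* V. Cossart, U. Jannsen, S. Saito, LNM 2270 (2020), Def. 6.34 (6.25), Def. 6.38, Rem. 6.29 (1). [CossartJannsenSaito2020]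
-/

noncomputable section

set_option linter.dupNamespace false -- mandated namespace of this single-conjunct summit

open CategoryTheory AlgebraicGeometry TopologicalSpace Topology
open Literature.AlgebraicGeometry.Resolution Literature.RingTheory.HilbertSamuel
open Literature.AlgebraicGeometry.CossartJannsenSaito2020
open Summit.ResolutionOfSingularities.ResolutionOfSingularities.Theorems.CampaignW42
open Summit.ResolutionOfSingularities.ResolutionOfSingularities.Theorems.SigmaMaxModificationsCorridor3.Moving

namespace Summit.ResolutionOfSingularities.ResolutionOfSingularities.Theorems.SigmaMaxModificationsCorridor3.Helpers

universe u

variable {R : ∀ S : Scheme.{u}, CentreSeq S → Prop} {N : ℕ} {ν : ℕ → ℕ}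

/-! ## §1 The projection and the centre of each step of a chain -/

section Chain

variable {c : ℕ → MarkedStage.{u}} (hstep : ∀ n, CanonicalNearStep R N ν (c n) (c (n + 1)))

/-- [OURS] THE projection `X_{n+1} ⟶ X_n` of the `n`-th step of the chain (a chosen step projection). [folklore] -/
def chainProj (n : ℕ) : (c (n + 1)).W ⟶ (c n).W :=
  Classical.choose (hstep n).exists_stepProjection

/-- The chosen projection IS a step projection of the `n`-th step. [folklore] -/
theorem stepProjection_chainProj (n : ℕ) : StepProjection R N ν (c n) (c (n + 1)) (chainProj hstep n) :=
  Classical.choose_spec (hstep n).exists_stepProjection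

/-- [OURS] THE centre `C_n ⊆ X_n` of the `n`-th step of the chain (the canonical centre from the state of `c n`). [folklore] -/
def chainCentre (n : ℕ) : (c n).W.IdealSheafData :=
  Classical.choose (stepProjection_chainProj hstep n)

/-- The defining package of the chosen centre: it is the canonical centre, the next stage is its blow-up carrying a closed near point
over `x_n`, and the projection is `π_{C_n}` read on `X_{n+1}`. [folklore] -/
theorem chainCentre_spec (n : ℕ) :
    ∃ (P' : Option (Pending (blowup (chainCentre hstep n)))) (h : IsLocallyNoetherian (blowup (chainCentre hstep n)))
      (x' : ↥(blowup (chainCentre hstep n))),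
      IsCanonicalStep R N ν (c n).L (c n).P (chainCentre hstep n) P' ∧ (blowup.π (chainCentre hstep n)).base x' = (c n).pt ∧
        IsClosed ({x'} : Set ↥(blowup (chainCentre hstep n))) ∧ x' ∈ Scheme.hsStratum (blowup (chainCentre hstep n)) N ν ∧
        ∃ e : c (n + 1) = ⟨blowup (chainCentre hstep n), h, (c n).L.next (Scheme.hsStratum (c n).W N ν) (chainCentre hstep n), P', x'⟩,
          chainProj hstep n = eqToHom (congrArg MarkedStage.W e) ≫ blowup.π (chainCentre hstep n) :=
  Classical.choose_spec (stepProjection_chainProj hstep n)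

/-- The chosen centre is the centre of a canonical step from the state of `c n`. [folklore] -/
theorem isCanonicalStep_chainCentre (n : ℕ) :
    ∃ P' : Option (Pending (blowup (chainCentre hstep n))), IsCanonicalStep R N ν (c n).L (c n).P (chainCentre hstep n) P' := by
  obtain ⟨P', -, -, hcs, -⟩ := chainCentre_spec hstep n
  exact ⟨P', hcs⟩

/-- **The projection of the `n`-th step IS a blow-up of `X_n` in `C_n`** (the chosen blowing up, transported along the identification
of the stage `X_{n+1}` with `Bl_{C_n}(X_n)`). [cite: GortzWedhorn2020, Def. 13.90] -/
theorem isBlowup_chainProj (n : ℕ) : IsBlowup (chainProj hstep n) (chainCentre hstep n) := by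
  obtain ⟨P', h, x', -, -, -, -, e, hf⟩ := chainCentre_spec hstep n
  rw [hf]
  exact (blowup.isBlowup (chainCentre hstep n)).iso_comp (eqToIso (congrArg MarkedStage.W e))

/-- The projection maps the marked point to the marked point: `π_n(x_{n+1}) = x_n`. [folklore] -/
theorem chainProj_base_pt (n : ℕ) : (chainProj hstep n).base (c (n + 1)).pt = (c n).pt :=
  (stepProjection_chainProj hstep n).base_pt

/-- **GENUINE ⇔ the marked point lies in the chosen centre** (functional oracle: the canonical centre is unique,
`IsCanonicalStep.centre_unique`). [cite: CossartJannsenSaito2020, Rem. 6.29 (1)] -/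
theorem isBlownUp_iff_pt_mem_chainCentre (hRf : OracleFunctional R) (n : ℕ) :
    (c n).IsBlownUp R N ν ↔ (c n).pt ∈ ((chainCentre hstep n).support : Set (c n).W) := by
  obtain ⟨P', hcs⟩ := isCanonicalStep_chainCentre hstep n
  constructor
  · rintro ⟨C', P'', hcs', hmem⟩
    obtain rfl : C' = chainCentre hstep n := hcs'.centre_unique hRf hcs
    exact hmem
  · intro h
    exact ⟨chainCentre hstep n, P', hcs, h⟩

include hstep in
/-- The marked points stay in the `ν`-strata along the chain once `x_0 ∈ X_0(ν)`. [folklore] -/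
theorem pt_mem_hsStratum_chain (h0 : (c 0).pt ∈ Scheme.hsStratum (c 0).W N ν) (n : ℕ) :
    (c n).pt ∈ Scheme.hsStratum (c n).W N ν := by
  induction n with
  | zero => exact h0
  | succ n _ => exact (hstep n).pt_mem_hsStratum

end Chain

/-! ## §2 Radical centres: regular closed subschemes have radical ideal sheaves -/

/-- A closed subscheme `V(C)` which is REGULAR (hence reduced) is cut out by the vanishing ideal sheaf of its support: `C = 𝓘(V(C))`.
[folklore] -/
theorem eq_vanishingIdeal_support_of_isRegular_subscheme {W : Scheme.{u}} (C : W.IdealSheafData)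
    (hreg : Literature.AlgebraicGeometry.Resolution.Scheme.IsRegular C.subscheme) :
    C = Scheme.IdealSheafData.vanishingIdeal C.support := by
  haveI : IsReduced C.subscheme := by
    haveI : ∀ z : C.subscheme, _root_.IsReduced (C.subscheme.presheaf.stalk z) := fun z => by
      haveI := hreg z
      haveI := isDomain_of_isRegularLocalRing (C.subscheme.presheaf.stalk z)
      infer_instance
    exact isReduced_of_isReduced_stalk C.subscheme
  have h := ker_eq_vanishingIdeal_range C.subschemeι (by rw [Scheme.IdealSheafData.range_subschemeι]; exact C.support.isClosed)
  rw [Scheme.IdealSheafData.ker_subschemeι] at h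
  calc C = _ := h
    _ = Scheme.IdealSheafData.vanishingIdeal C.support := by
        congr 1
        exact Closeds.ext (Scheme.IdealSheafData.range_subschemeι C)

/-! ## §3 The tower of the chain -/

section Tower

variable {c : ℕ → MarkedStage.{u}} (hstep : ∀ n, CanonicalNearStep R N ν (c n) (c (n + 1)))
  (hrad : ∀ n, chainCentre hstep n = Scheme.IdealSheafData.vanishingIdeal (chainCentre hstep n).support)

/-- [OURS · L1 W4.2] **THE BLOW-UP TOWER OF THE CHAIN** (CJS `BlowupTower`, the display (6.25) of Def. 6.34): stages `X_n = (c n).W`,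
centres `V(C_n)`, projections the step projections — for RADICAL centres `hrad` (canonical centres are regular, hence radical:
`eq_vanishingIdeal_support_of_isRegular_subscheme` with `Helpers.CycleInv.centre`). OURS bookkeeping; NOT a statement of the manuscript.
[cite: CossartJannsenSaito2020, Def. 6.34] -/
def chainTower : BlowupTower.{u} where
  X n := (c n).W
  ln n := (c n).ln
  C n := ((chainCentre hstep n).support : Set (c n).W)
  isClosed_C n := (chainCentre hstep n).support.isClosed
  π n := chainProj hstep n
  isBlowup n := by
    have h : Scheme.IdealSheafData.vanishingIdeal ⟨((chainCentre hstep n).support : Set (c n).W),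
        (chainCentre hstep n).support.isClosed⟩ = chainCentre hstep n := (hrad n).symm
    rw [h]
    exact isBlowup_chainProj hstep n

/-- Unfolding: the stages. [folklore] -/
@[simp] theorem chainTower_X (n : ℕ) : (chainTower hstep hrad).X n = (c n).W := rfl

/-- Unfolding: the centres. [folklore] -/
@[simp] theorem chainTower_C (n : ℕ) : (chainTower hstep hrad).C n = ((chainCentre hstep n).support : Set (c n).W) := rfl

/-- Unfolding: the projections. [folklore] -/
@[simp] theorem chainTower_π (n : ℕ) : (chainTower hstep hrad).π n = chainProj hstep n := rfl

/-- The centre ideal of the tower is the chain's centre. [folklore] -/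
theorem centreIdeal_chainTower (n : ℕ) : (chainTower hstep hrad).centreIdeal n = chainCentre hstep n :=
  (hrad n).symm

/-- `φ_n(x_n) = x_0`: the marked points lie over the initial marked point. [cite: CossartJannsenSaito2020, Def. 6.34 (ii)] -/
theorem phi_chainTower_base_pt (n : ℕ) : ((chainTower hstep hrad).phi n).base (c n).pt = (c 0).pt := by
  induction n with
  | zero => rfl
  | succ n ih =>
    rw [BlowupTower.phi_succ_base]
    show ((chainTower hstep hrad).phi n).base ((chainProj hstep n).base (c (n + 1)).pt) = (c 0).pt
    rw [chainProj_base_pt, ih]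

/-- **The marked points are NEAR POINTS over `x_0`** in the tower: `x_n ∈ T.nearLocus N x_0 n` (over `x_0`, same `H^N = ν`), once
`x_0 ∈ X_0(ν)`. [cite: CossartJannsenSaito2020, Def. 6.34 (ii), Def. 6.38 (iii)] -/
theorem pt_mem_nearLocus_chainTower (h0 : (c 0).pt ∈ Scheme.hsStratum (c 0).W N ν) (n : ℕ) :
    (c n).pt ∈ (chainTower hstep hrad).nearLocus N (c 0).pt n := by
  refine ⟨phi_chainTower_base_pt hstep hrad n, ?_⟩
  show Scheme.hsFun (c n).W N (c n).pt = Scheme.hsFun (c 0).W N (c 0).pt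
  rw [Scheme.mem_hsStratum_iff.mp (pt_mem_hsStratum_chain hstep h0 n), Scheme.mem_hsStratum_iff.mp h0]

/-- The tower's `ē` at the marked point is the marked stage's grade. [folklore] -/
theorem geomDirDimAt_chainTower_pt (n : ℕ) : (chainTower hstep hrad).geomDirDimAt n (c n).pt = (c n).geomDirDim := rfl

/-- The tower's `e` at the marked point is the marked stage's `e`. [folklore] -/
theorem dirDimAt_chainTower_pt (n : ℕ) : (chainTower hstep hrad).dirDimAt n (c n).pt = Moving.dirDim (c n) := rfl

/-- In the tower, GENUINE at `n` ⇔ `x_n ∈ C_n` (functional oracle). [cite: CossartJannsenSaito2020, Rem. 6.29 (1)] -/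
theorem pt_mem_chainTower_C_iff (hRf : OracleFunctional R) (n : ℕ) :
    (c n).pt ∈ (chainTower hstep hrad).C n ↔ (c n).IsBlownUp R N ν :=
  (isBlownUp_iff_pt_mem_chainCentre hstep hRf n).symm

/-- **`KeySetting T N`** for the chain tower from an excellent initial stage of dimension `≤ N`. [cite: CossartJannsenSaito2020, Thm. 6.28 (setting)] -/
theorem keySetting_chainTower (hexc : Scheme.IsExcellent (c 0).W) (hdim : topologicalKrullDim (c 0).W ≤ (N : WithBot ℕ∞)) :
    KeySetting (chainTower hstep hrad) N :=
  ⟨hexc, hdim⟩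

end Tower

end Summit.ResolutionOfSingularities.ResolutionOfSingularities.Theorems.SigmaMaxModificationsCorridor3.Helpers

end
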